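import Literature.NumberTheory.EllipticCurves.KellerYin2024.AnomalousLambdaInvariants
import Literature.NumberTheory.GaloisRepresentations.TeichmullerCharacter
import Literature.NumberTheory.EllipticCurves.GaloisActionProofs
import HarnessLib

/-!
# Uniqueness of the Teichmüller lift on a cyclic subquotient, and of the residual pair
# `(θsub, θquot)` of `E[p]` over `K` given the stable line (Keller–Yin 2024 §1.4 — reading lemmas)

Cell `bsd-eis` (FULL-BSD rank-≤1 programme, home `run/shared/lean/pub/bsd-eis/`), width seat
`bsd-line-x1-p1-w2` gen 15, crux 2 `GoodLatticeBDPValue` (stmt-BirchSwinnertonDyer-19032), line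
`halves` v33N. PROVED READING LEMMAS (no definition, no named fact, no `sorry`) about the tree's
predicates `IsTeichmullerLiftOnQuot S N T θ` (`LatticeCharacters.lean`) and
`IsResidualPairOver WK p θsub θquot` (`AnomalousLambdaInvariants.lean`), which the CGLS-Thm.-2.2.2-
shaped named facts `KellerYin2024.thm222_anacong_goodLattice_{of_ne_one, of_five_le,
of_fullDescentDatum, OPEN}` bind UNIVERSALLY (`∀ θsub θquot, IsResidualPairOver (W.baseChange K) p
θsub θquot → …`) where print (Castella–Grossi–Lee–Skinner 2022 Thm. 2.2.2, Keller–Yin 2024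
Thm. 2.2.2) speaks of THE characters `φ, ψ` of `E[p]^{ss}`:

* `IsTeichmullerLiftOnQuot.eq_of_forall_dvd` — two Teichmüller lifts of the `Γ_K`-action on the
  same subquotient `T/N` coincide as soon as `T/N` has exponent divisible by `p` (an integer acting
  into `N` on `T` is divisible by `p`): their values are `(p−1)`-th roots of unity of `𝓞 ⊂ ℚ̄_p`
  congruent to the same residue, hence equal (`eq_of_pow_eq_one_of_norm_sub_lt_one`, Hensel);
* `dvd_of_forall_zsmul_mem_bot`, `dvd_of_forall_zsmul_mem` — the exponent hypothesis for
  `T/N = Φ/0` (`|Φ| = p`) and for `T/N = E[p]/Φ` (`|Φ| = p < |E[p]|`);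
* `IsResidualPairOver.eq_of_unique_line` / `…_of_charZero` — if `E[p](K̄)` has at most ONE
  `Γ_K`-stable subgroup of order `p` (and more than `p` points — automatic in characteristic `0`,
  `#E[p] = p²`, tree theorem `card_torsionPoints_eq_sq_holds`), the residual pair is unique.

So on the `θ`-axis those statements quantify over ONE pair whenever the stable line is unique —
which is the good-lattice situation of crux 2 (`∀ Φ, IsRationalLine W p Φ → ¬ LineUnramifiedAt W p Φ`
at a good ordinary `p` forces a unique rational line, `E[p]|_{G_ℚ}` non-split with distinct
characters, and non-splitness survives restriction to the index-two subgroup `Γ_K` for odd `p`;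
that last implication is NOT proved here — the lemmas take uniqueness of the line as a hypothesis).
Plumbing: `coe_det_eq_entry`, `entry_pow_eq_one_of_pow_eq_one`, `apply_eq_of_entry_eq` (rank-one
framed representations are their entry). No summit statement, no case of BSD, no crux or stub is
proved by this file; 0 cells / labels / tiers move.

References: [KellerYin2024] §1.4 display (char to f) (arXiv:2402.12781v2 TeX L1066–1081), §1.1
(L441: Teichmüller lift); [CastellaGrossiLeeSkinner2022] Thm. 2.2.2 (`cor:Kriz`); [LangCyclotomic1990]
Ch. 1 §2; [SilvermanAEC2009] Cor. III.6.4(b).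
-/

noncomputable section

open scoped Classical

open NumberField Field WeierstrassCurve
open Literature.NumberTheory.EllipticCurves Literature.NumberTheory.GaloisRepresentations

namespace Literature.NumberTheory.EllipticCurves.KellerYin2024

section Unique

variable {K : Type} [Field K] {p : ℕ} [hp : Fact p.Prime] {S : Set (PadicAlgCl p)}
  {M : Type*} [AddCommGroup M] [DistribMulAction (absoluteGaloisGroup K) M]

/-- The entry of a rank-one framed representation is its determinant. [folklore] -/
private theorem coe_det_eq_entry (θ : FramedGaloisRep K (padicCoeffIntegers S) 1)
    (σ : absoluteGaloisGroup K) :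
    ((Matrix.GeneralLinearGroup.det (θ σ) : (padicCoeffIntegers S)ˣ) : padicCoeffIntegers S) =
      entry S θ σ := by
  rw [Matrix.GeneralLinearGroup.val_det_apply, Matrix.det_fin_one]
  rfl

/-- If `θ(σ)^k = 1` in `GL₁(𝓞)` then `entry θ σ ^ k = 1` in `𝓞`. [folklore] -/
private theorem entry_pow_eq_one_of_pow_eq_one {θ : FramedGaloisRep K (padicCoeffIntegers S) 1}
    {σ : absoluteGaloisGroup K} {k : ℕ} (h : θ σ ^ k = 1) : entry S θ σ ^ k = 1 := by
  rw [← coe_det_eq_entry, ← Units.val_pow_eq_pow_val, ← map_pow, h, map_one, Units.val_one]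

/-- Two elements of `GL₁(𝓞)` with the same entry are equal. [folklore] -/
private theorem apply_eq_of_entry_eq {θ θ' : FramedGaloisRep K (padicCoeffIntegers S) 1}
    {σ : absoluteGaloisGroup K} (h : entry S θ σ = entry S θ' σ) : θ σ = θ' σ := by
  refine Matrix.GeneralLinearGroup.ext fun i j ↦ ?_
  have hi : i = 0 := Subsingleton.elim i 0
  have hj : j = 0 := Subsingleton.elim j 0
  subst hi hj
  exact h

/-- **Uniqueness of the Teichmüller lift on a cyclic subquotient of exponent divisible by `p`.**
If `θ` and `θ'` are both Teichmüller lifts of the action of `Γ_K` on `T/N`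
(`IsTeichmullerLiftOnQuot S N T`), and `T/N` has an element of additive order divisible by `p`
(hypothesis: an integer acting into `N` on all of `T` is divisible by `p` — e.g. `T/N ≅ ℤ/p`), then
`θ = θ'`: both values at `σ` are `(p−1)`-th roots of unity of `𝓞 ⊂ ℚ̄_p` congruent modulo the
maximal ideal to the same scalar `a ≡ a' (mod p)`, hence equal (Hensel: distinct prime-to-`p`
roots of unity are incongruent, `eq_of_pow_eq_one_of_norm_sub_lt_one`).
[cite: KellerYin2024, §1.1 (arXiv:2402.12781v2 TeX L441: "via the Teichmüller lift we view `θ` as taking values in `𝓞^×`")]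
[cite: LangCyclotomic1990, Ch. 1 §2 (Teichmüller representatives)] -/
theorem IsTeichmullerLiftOnQuot.eq_of_forall_dvd {N T : AddSubgroup M}
    {θ θ' : FramedGaloisRep K (padicCoeffIntegers S) 1}
    (h : IsTeichmullerLiftOnQuot S N T θ) (h' : IsTeichmullerLiftOnQuot S N T θ')
    (hNT : ∀ b : ℤ, (∀ P ∈ T, b • P ∈ N) → (p : ℤ) ∣ b) : θ = θ' := by
  refine ContinuousMonoidHom.ext fun σ ↦ ?_
  obtain ⟨a, ha, haN⟩ := h.2 σ
  obtain ⟨a', ha', haN'⟩ := h'.2 σ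
  -- the two integer scalars agree modulo `p`
  have hdvd : (p : ℤ) ∣ (a' - a) := hNT _ fun P hP ↦ by
    have hmem := N.sub_mem (haN P hP) (haN' P hP)
    rwa [sub_sub_sub_cancel_left, ← sub_smul] at hmem
  -- both entries are `(p-1)`-th roots of unity in `ℚ̄_p`
  have hp1 : 0 < p - 1 := Nat.sub_pos_of_lt hp.out.one_lt
  have hpd : ¬ p ∣ (p - 1) := Nat.not_dvd_of_pos_of_lt hp1 (Nat.sub_lt hp.out.pos Nat.one_pos)
  have hμ : ((entry S θ σ : padicCoeffIntegers S) : PadicAlgCl p) ^ (p - 1) = 1 := by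
    rw [← Subring.coe_pow, entry_pow_eq_one_of_pow_eq_one (h.1 σ), Subring.coe_one]
  have hν : ((entry S θ' σ : padicCoeffIntegers S) : PadicAlgCl p) ^ (p - 1) = 1 := by
    rw [← Subring.coe_pow, entry_pow_eq_one_of_pow_eq_one (h'.1 σ), Subring.coe_one]
  -- and they are congruent modulo the maximal ideal
  have haa' : ‖(a : PadicAlgCl p) - (a' : PadicAlgCl p)‖ < 1 := by
    obtain ⟨c, hc⟩ := hdvd
    have e : (a : PadicAlgCl p) - (a' : PadicAlgCl p) = -((p : PadicAlgCl p) * (c : PadicAlgCl p)) := by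
      rw [← Int.cast_natCast, ← Int.cast_mul, ← hc]
      push_cast
      ring
    have hnp : ‖(p : PadicAlgCl p)‖ < 1 := by
      rw [← map_natCast (algebraMap ℚ_[p] (PadicAlgCl p)) p, ← PadicAlgCl.coe_eq]
      change ‖((p : ℚ_[p]) : PadicAlgCl p)‖ < 1
      rw [PadicAlgCl.norm_extends, Padic.norm_p]
      exact inv_lt_one_of_one_lt₀ (by exact_mod_cast hp.out.one_lt)
    rw [e, norm_neg, norm_mul]
    exact mul_lt_one_of_nonneg_of_lt_one_left (norm_nonneg _) hnp
      (IsUltrametricDist.norm_intCast_le_one (PadicAlgCl p) c)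
  have hclose : ‖((entry S θ σ : padicCoeffIntegers S) : PadicAlgCl p) -
      ((entry S θ' σ : padicCoeffIntegers S) : PadicAlgCl p)‖ < 1 := by
    have e : ((entry S θ σ : padicCoeffIntegers S) : PadicAlgCl p) -
        ((entry S θ' σ : padicCoeffIntegers S) : PadicAlgCl p) =
        (((entry S θ σ : padicCoeffIntegers S) : PadicAlgCl p) - (a : PadicAlgCl p)) +
          (((a : PadicAlgCl p) - (a' : PadicAlgCl p)) +
            ((a' : PadicAlgCl p) - ((entry S θ' σ : padicCoeffIntegers S) : PadicAlgCl p))) := by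
      ring
    rw [e]
    refine (IsUltrametricDist.norm_add_le_max _ _).trans_lt (max_lt ha ?_)
    refine (IsUltrametricDist.norm_add_le_max _ _).trans_lt (max_lt haa' ?_)
    rwa [← norm_neg, neg_sub]
  have heq := eq_of_pow_eq_one_of_norm_sub_lt_one hp1 hpd hμ hν hclose
  exact apply_eq_of_entry_eq (Subtype.ext heq)

/-- In a subgroup `Φ` of prime order `p` killed by `p`, an integer acting as `0` on `Φ` is divisible
by `p` (take `P ∈ Φ`, `P ≠ 0`: its additive order is `p`). [folklore] -/
private theorem dvd_of_forall_zsmul_mem_bot {A : Type*} [AddCommGroup A] {Φ : AddSubgroup A}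
    (hcard : Nat.card Φ = p) (hΦ : ∀ P ∈ Φ, (p : ℤ) • P = 0) (b : ℤ)
    (hb : ∀ P ∈ Φ, b • P ∈ (⊥ : AddSubgroup A)) : (p : ℤ) ∣ b := by
  haveI : Finite Φ := Nat.finite_of_card_ne_zero (by rw [hcard]; exact hp.out.ne_zero)
  haveI : Nontrivial Φ := Finite.one_lt_card_iff_nontrivial.mp (by rw [hcard]; exact hp.out.one_lt)
  obtain ⟨⟨P, hP⟩, hP0⟩ := exists_ne (0 : Φ)
  have hP0' : P ≠ 0 := fun h ↦ hP0 (Subtype.ext h)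
  have hord : addOrderOf P = p := by
    have hdvd : addOrderOf P ∣ p := by
      refine addOrderOf_dvd_iff_nsmul_eq_zero.mpr ?_
      have := hΦ P hP
      rwa [natCast_zsmul] at this
    rcases (Nat.dvd_prime hp.out).mp hdvd with h1 | h1
    · exact absurd (AddMonoid.addOrderOf_eq_one_iff.mp h1) hP0'
    · exact h1
  have hb0 : b • P = 0 := (AddSubgroup.mem_bot).mp (hb P hP)
  have := addOrderOf_dvd_iff_zsmul_eq_zero.mpr hb0
  rwa [hord] at this

/-- If `Φ ≤ T` are subgroups with `T` killed by `p`, `|Φ| = p < |T|`, then an integer `b` mapping `T`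
into `Φ` is divisible by `p` (otherwise `b` is invertible modulo `p` on `T` and `T ⊆ Φ`). [folklore] -/
private theorem dvd_of_forall_zsmul_mem {A : Type*} [AddCommGroup A] {Φ T : AddSubgroup A}
    (hcard : Nat.card Φ = p) (hT : p < Nat.card T) (hTp : ∀ P ∈ T, (p : ℤ) • P = 0) (b : ℤ)
    (hb : ∀ P ∈ T, b • P ∈ Φ) : (p : ℤ) ∣ b := by
  by_contra hnd
  -- `b` is invertible modulo `p`
  have hcop : IsCoprime (p : ℤ) b :=
    (Nat.prime_iff_prime_int.mp hp.out).irreducible.coprime_iff_not_dvd.mpr hnd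
  obtain ⟨d, c, hcd⟩ := hcop
  have hle : T ≤ Φ := fun P hP ↦ by
    have e : P = c • (b • P) := by
      have h1 : (d * (p : ℤ) + c * b) • P = P := by rw [hcd, one_smul]
      rw [add_smul, mul_smul, mul_smul, hTp P hP, smul_zero, zero_add] at h1
      exact h1.symm
    rw [e]
    exact Φ.zsmul_mem (hb P hP) c
  haveI : Finite Φ := Nat.finite_of_card_ne_zero (by rw [hcard]; exact hp.out.ne_zero)
  have := Nat.card_le_card_of_injective _ (AddSubgroup.inclusion_injective hle)
  omega

/-- **Uniqueness of the residual pair given uniqueness of the stable line.** If `E[p](K̄)` has MORE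
than `p` points (an elliptic curve in characteristic `≠ p`: `p²`) and at most one `Γ_K`-stable
subgroup of order `p` (the good-lattice situation: `E[p]|_{G_ℚ}` non-split with distinct characters
stays non-split on the index-two subgroup `Γ_K` for odd `p`), then the residual pair
`(θsub, θquot)` of `IsResidualPairOver` is unique: both components are Teichmüller lifts on the
cyclic subquotients `Φ` and `E[p]/Φ` of order `p` (`IsTeichmullerLiftOnQuot.eq_of_forall_dvd`).
Reading lemma for the `∀ θsub θquot, IsResidualPairOver … →` binders of
`KellerYin2024.thm222_anacong_goodLattice_{of_ne_one,of_five_le,of_fullDescentDatum,OPEN}`.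
[cite: KellerYin2024, §1.4 display (char to f) (arXiv:2402.12781v2 TeX L1066–1081)]
[cite: CastellaGrossiLeeSkinner2022, Thm. 2.2.2 (hypothesis "`E[p]^{ss} = 𝔽_p(φ) ⊕ 𝔽_p(ψ)`")] -/
theorem IsResidualPairOver.eq_of_unique_line {WK : WeierstrassCurve K}
    {θsub θquot θsub' θquot' : FramedGaloisRep K (padicCoeffIntegers S) 1}
    (h : IsResidualPairOver WK p θsub θquot) (h' : IsResidualPairOver WK p θsub' θquot')
    (hbig : p < Nat.card (geomTorsion WK (p : ℤ)))
    (huniq : ∀ Φ Φ' : AddSubgroup (geomPoints WK), Nat.card Φ = p → Φ ≤ geomTorsion WK (p : ℤ) →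
      (∀ σ : absoluteGaloisGroup K, ∀ P ∈ Φ, σ • P ∈ Φ) → Nat.card Φ' = p →
      Φ' ≤ geomTorsion WK (p : ℤ) → (∀ σ : absoluteGaloisGroup K, ∀ P ∈ Φ', σ • P ∈ Φ') → Φ = Φ') :
    θsub = θsub' ∧ θquot = θquot' := by
  obtain ⟨Φ, hcard, hle, hstab, hsub, hquot⟩ := h
  obtain ⟨Φ', hcard', hle', hstab', hsub', hquot'⟩ := h'
  obtain rfl : Φ = Φ' := huniq Φ Φ' hcard hle hstab hcard' hle' hstab'
  have hΦp : ∀ P ∈ Φ, (p : ℤ) • P = 0 := fun P hP ↦ (Submodule.mem_torsionBy_iff (p : ℤ) P).mp (hle hP)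
  have hTp : ∀ P ∈ geomTorsion WK (p : ℤ), (p : ℤ) • P = 0 := fun P hP ↦
    (Submodule.mem_torsionBy_iff (p : ℤ) P).mp hP
  exact ⟨hsub.eq_of_forall_dvd hsub' (dvd_of_forall_zsmul_mem_bot hcard hΦp),
    hquot.eq_of_forall_dvd hquot' (dvd_of_forall_zsmul_mem hcard hbig hTp)⟩

/-- **Uniqueness of the residual pair for an elliptic curve in characteristic `0`, given uniqueness
of the stable line**: `#E[p](K̄) = p² > p` (Silverman AEC III.6.4(b), tree theorem
`card_torsionPoints_eq_sq_holds`), so `IsResidualPairOver.eq_of_unique_line` applies with only the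
unique-line hypothesis left. [cite: SilvermanAEC2009, Cor. III.6.4(b)]
[cite: KellerYin2024, §1.4 display (char to f) (arXiv:2402.12781v2 TeX L1066–1081)] -/
theorem IsResidualPairOver.eq_of_unique_line_of_charZero [CharZero K] {WK : WeierstrassCurve K}
    [WK.IsElliptic] {θsub θquot θsub' θquot' : FramedGaloisRep K (padicCoeffIntegers S) 1}
    (h : IsResidualPairOver WK p θsub θquot) (h' : IsResidualPairOver WK p θsub' θquot')
    (huniq : ∀ Φ Φ' : AddSubgroup (geomPoints WK), Nat.card Φ = p → Φ ≤ geomTorsion WK (p : ℤ) →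
      (∀ σ : absoluteGaloisGroup K, ∀ P ∈ Φ, σ • P ∈ Φ) → Nat.card Φ' = p →
      Φ' ≤ geomTorsion WK (p : ℤ) → (∀ σ : absoluteGaloisGroup K, ∀ P ∈ Φ', σ • P ∈ Φ') → Φ = Φ') :
    θsub = θsub' ∧ θquot = θquot' := by
  refine h.eq_of_unique_line h' ?_ huniq
  haveI : CharZero (AlgebraicClosure K) :=
    charZero_of_injective_algebraMap (algebraMap K (AlgebraicClosure K)).injective
  have hc : Nat.card (geomTorsion WK (p : ℤ)) = p ^ 2 :=
    card_torsionPoints_eq_sq_holds WK (AlgebraicClosure K) (Nat.cast_ne_zero.mpr hp.out.ne_zero)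
  rw [hc]
  exact lt_self_pow₀ hp.out.one_lt one_lt_two

end Unique

end Literature.NumberTheory.EllipticCurves.KellerYin2024

end
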